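import Summits.CriticalPhenomena.PercolationContinuityZ3.Theorems.PercNearOneGluingNoHeavyLowerTailFaceIIAtom
import Summits.CriticalPhenomena.PercolationContinuityZ3.Theorems.PercNearOneGluingNoHeavyLowerTailSpectatorExchangeRobust
import HarnessLib

/-!
# `NoHeavyLowerTail` (stmt-CriticalPhenomena-4575) — the FORMAL FACE of the `2 + (any law)` kernel, WEAKEST-WITNESS regime (I = A′), ONE ATOM:
# `f_Y ≥ (1−u)·r_{q*,Y}` whenever the witness `j` is the least `b`-reliable of `p*, p′, j` in `K_u/Y` (memo LF3-BETA-R §16a, §17)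

Support file (lemma factory `prim-lf-3` gen 13; `--supports stmt-CriticalPhenomena-4575`).  No definitions, no named facts, no sorries.

Setting as in `faceB_atom` / `faceII_atom`: a core `w`, a block `Y ∌ b` glued (`L := glue_Y w`), a pair `{c, d}` disjoint from `Y`,
`M := L[s(c,d) ↦ 1]`, `N := M[s(c,s₀) ↦ 1]` (`s₀ ∈ Y`), the mixture `R := (1−u)·L + u·M` (the graph `K_u/Y` of the memo), a vertex `q` at most as
connected as some `y ∈ Y` in the mixture `(1−u)·w + u·w[cd ↦ 1]`, and a witness `j`.  `faceII_atom` (gen 11) treated regime II (a port `c` is the least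
`b`-reliable of `c, d, j` in `R`, certificate `(u, 1−u)`); THIS FILE treats the complementary regime I = A′ of the memo: the WITNESS is the least
`b`-reliable of the three in `R` (`μ_R(j↔b) ≤ μ_R(c↔b)`, `μ_R(j↔b) ≤ μ_R(d↔b)`), certificate `(0, 1−u)`; the conclusion is

  `(1−u)[(1−u)(μ_L(qb) − μ_L(jb)) + u(μ_M(qb) − μ_M(jb))] ≤ (1−u)[μ_L(s₀b) − μ_L(jb)] + u[μ_N(cb) − μ_N(jb)]`,

i.e. the face value `f_Y` dominates `(1−u)·r_{q,Y}` (memo §16a regime I; the lead's atom inequality Ψ_Y = T(i)).  Proof: verbatim the proof of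
`faceII_atom` with the SPECTATOR-WEAKEST exchange `spectatorExchange_weakest` (gen 13, from the coupling seat's robust Question 7
`Q7Psi.q7_three_robust`) in place of `spectatorExchange`: the difference of the two sides is `u·[D − (μ_R(jb) − μ_R(s₀b))] + (1−u)·[Lemma 5 slack]`
with `D = μ_M(cb, s₀↮b, j↮s₀) − μ_M(s₀b, c↮b, j↔c)`, and `D ≥ μ_R(jb) − μ_R(s₀b)` is `spectatorExchange_weakest` in `R` (observer `s₀`, pair `{c,d}`,
spectator `j`) transported to `M` along the gluing push-forward `ω ↦ ω ∪ {s(c,d)}`.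
-/

namespace Summit.CriticalPhenomena.PercolationContinuityZ3.Theorems

open MeasureTheory Set ProbabilityTheory
open Literature.Probability.LatticeModels
open Literature.Probability.Percolation

noncomputable section
open Classical

namespace UpsetExchange

variable {n : ℕ}

/-- **Weakest-witness regime (I = A′) of the formal face, one nonempty atom** (graph form).  See the module docstring.
[cite: KozmaNitzan2024, Question 9 (p. 36), Question 7 (p. 36), Lemma 5 (p. 13), (9) (pp. 9–10)] -/
theorem faceI_atom (w : Sym2 (Fin n) → unitInterval) (Y : Finset (Fin n)) (c d q j b s₀ y : Fin n) (u : unitInterval)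
    (hs₀ : s₀ ∈ Y) (hy : y ∈ Y) (hcY : c ∉ Y) (hdY : d ∉ Y) (hbY : b ∉ Y) (hjY : j ∉ Y) (hcd : c ≠ d)
    (hcb : c ≠ b) (hdb : d ≠ b) (hjb : j ≠ b) (hcj : c ≠ j) (hdj : d ≠ j)
    (hRjc : (1 - (u : ℝ)) * (prodBernoulli (fun e : Sym2 (Fin n) => if (∀ x ∈ e, x ∈ Y) ∧ ¬ e.IsDiag then 1 else w e)).real (openConn j b) +
        (u : ℝ) * (prodBernoulli (fun f : Sym2 (Fin n) => if f = s(c, d) then 1 else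
          (if (∀ x ∈ f, x ∈ Y) ∧ ¬ f.IsDiag then 1 else w f))).real (openConn j b) ≤
      (1 - (u : ℝ)) * (prodBernoulli (fun e : Sym2 (Fin n) => if (∀ x ∈ e, x ∈ Y) ∧ ¬ e.IsDiag then 1 else w e)).real (openConn c b) +
        (u : ℝ) * (prodBernoulli (fun f : Sym2 (Fin n) => if f = s(c, d) then 1 else
          (if (∀ x ∈ f, x ∈ Y) ∧ ¬ f.IsDiag then 1 else w f))).real (openConn c b))
    (hRjd : (1 - (u : ℝ)) * (prodBernoulli (fun e : Sym2 (Fin n) => if (∀ x ∈ e, x ∈ Y) ∧ ¬ e.IsDiag then 1 else w e)).real (openConn j b) +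
        (u : ℝ) * (prodBernoulli (fun f : Sym2 (Fin n) => if f = s(c, d) then 1 else
          (if (∀ x ∈ f, x ∈ Y) ∧ ¬ f.IsDiag then 1 else w f))).real (openConn j b) ≤
      (1 - (u : ℝ)) * (prodBernoulli (fun e : Sym2 (Fin n) => if (∀ x ∈ e, x ∈ Y) ∧ ¬ e.IsDiag then 1 else w e)).real (openConn d b) +
        (u : ℝ) * (prodBernoulli (fun f : Sym2 (Fin n) => if f = s(c, d) then 1 else
          (if (∀ x ∈ f, x ∈ Y) ∧ ¬ f.IsDiag then 1 else w f))).real (openConn d b))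
    (hqy : (1 - (u : ℝ)) * (prodBernoulli w).real (openConn q b) +
        (u : ℝ) * (prodBernoulli (fun f : Sym2 (Fin n) => if f = s(c, d) then 1 else w f)).real (openConn q b) ≤
      (1 - (u : ℝ)) * (prodBernoulli w).real (openConn y b) +
        (u : ℝ) * (prodBernoulli (fun f : Sym2 (Fin n) => if f = s(c, d) then 1 else w f)).real (openConn y b)) :
    (1 - (u : ℝ)) * ((1 - (u : ℝ)) *
          ((prodBernoulli (fun e : Sym2 (Fin n) => if (∀ x ∈ e, x ∈ Y) ∧ ¬ e.IsDiag then 1 else w e)).real (openConn q b) -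
            (prodBernoulli (fun e : Sym2 (Fin n) => if (∀ x ∈ e, x ∈ Y) ∧ ¬ e.IsDiag then 1 else w e)).real (openConn j b)) +
        (u : ℝ) *
          ((prodBernoulli (fun f : Sym2 (Fin n) => if f = s(c, d) then 1 else
              (if (∀ x ∈ f, x ∈ Y) ∧ ¬ f.IsDiag then 1 else w f))).real (openConn q b) -
            (prodBernoulli (fun f : Sym2 (Fin n) => if f = s(c, d) then 1 else
              (if (∀ x ∈ f, x ∈ Y) ∧ ¬ f.IsDiag then 1 else w f))).real (openConn j b))) ≤
    (1 - (u : ℝ)) *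
        ((prodBernoulli (fun e : Sym2 (Fin n) => if (∀ x ∈ e, x ∈ Y) ∧ ¬ e.IsDiag then 1 else w e)).real (openConn s₀ b) -
          (prodBernoulli (fun e : Sym2 (Fin n) => if (∀ x ∈ e, x ∈ Y) ∧ ¬ e.IsDiag then 1 else w e)).real (openConn j b)) +
      (u : ℝ) *
        ((prodBernoulli (fun f : Sym2 (Fin n) => if f = s(c, s₀) then 1 else (if f = s(c, d) then 1 else
            (if (∀ x ∈ f, x ∈ Y) ∧ ¬ f.IsDiag then 1 else w f)))).real (openConn c b) -
          (prodBernoulli (fun f : Sym2 (Fin n) => if f = s(c, s₀) then 1 else (if f = s(c, d) then 1 else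
            (if (∀ x ∈ f, x ∈ Y) ∧ ¬ f.IsDiag then 1 else w f)))).real (openConn j b)) := by
  -- the graphs
  set L : Sym2 (Fin n) → unitInterval := fun e => if (∀ x ∈ e, x ∈ Y) ∧ ¬ e.IsDiag then 1 else w e with hL
  set M : Sym2 (Fin n) → unitInterval := fun f => if f = s(c, d) then 1 else L f with hM
  set N : Sym2 (Fin n) → unitInterval := fun f => if f = s(c, s₀) then 1 else M f with hN
  set wP : Sym2 (Fin n) → unitInterval := fun f => if f = s(c, d) then 1 else w f with hwP
  set R : Sym2 (Fin n) → unitInterval := fun f => if f = s(c, d) then Set.Icc.convexComb (L s(c, d)) 1 u else L f with hR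
  have hcs₀ : c ≠ s₀ := fun h => hcY (h ▸ hs₀)
  have hds₀ : d ≠ s₀ := fun h => hdY (h ▸ hs₀)
  have hjs₀ : j ≠ s₀ := fun h => hjY (h ▸ hs₀)
  have hs₀b : s₀ ≠ b := fun h => hbY (h ▸ hs₀)
  have hmeas : ∀ X : Set (BondConfig (Fin n)), MeasurableSet X := fun _ => MeasurableSet.of_discrete
  have hu0 : 0 ≤ (u : ℝ) := unitInterval.nonneg u
  have hu1 : 0 ≤ 1 - (u : ℝ) := sub_nonneg.2 (unitInterval.le_one u)
  have hmixL : ∀ X : Set (BondConfig (Fin n)), (prodBernoulli R).real X =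
      (1 - (u : ℝ)) * (prodBernoulli L).real X + (u : ℝ) * (prodBernoulli M).real X :=
    fun X => real_raisePair_eq_mix L s(c, d) u X
  -- the two rankings in `R`
  have hRjc' : (prodBernoulli R).real (openConn j b) ≤ (prodBernoulli R).real (openConn c b) := by
    rw [hmixL, hmixL]; exact hRjc
  have hRjd' : (prodBernoulli R).real (openConn j b) ≤ (prodBernoulli R).real (openConn d b) := by
    rw [hmixL, hmixL]; exact hRjd
  -- the spectator-weakest exchange in `R` (observer `s₀`, pair `{c,d}`, spectator `j`)
  have hSE := spectatorExchange_weakest R b s₀ j c d hs₀b hcb hdb hjb hcd hcj hdj hRjc' hRjd'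
  -- the gluing push-forward `ω ↦ ω ∪ {s(c,d)}`: from `L` and from `M` onto `M`
  have hpushL : ∀ G : Set (BondConfig (Fin n)), (prodBernoulli M).real G =
      (prodBernoulli L).real {ω : BondConfig (Fin n) | ((ω ∪ {s(c, d)} : Set (Sym2 (Fin n))) : BondConfig (Fin n)) ∈ G} :=
    fun G => glueSet_pushforward L M ({s(c, d)} : Set (Sym2 (Fin n)))
      (fun e he => by rw [Set.mem_singleton_iff.1 he]; simp only [hM, if_true])
      (fun e he => by simp only [hM, if_neg (fun h => he (Set.mem_singleton_iff.2 h))]) G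
  have hpushM : ∀ G : Set (BondConfig (Fin n)), (prodBernoulli M).real G =
      (prodBernoulli M).real {ω : BondConfig (Fin n) | ((ω ∪ {s(c, d)} : Set (Sym2 (Fin n))) : BondConfig (Fin n)) ∈ G} :=
    fun G => glueSet_pushforward M M ({s(c, d)} : Set (Sym2 (Fin n)))
      (fun e he => by rw [Set.mem_singleton_iff.1 he]; simp only [hM, if_true]) (fun e _ => rfl) G
  -- (P1) the first `R`-event is carried into `{cb, s₀↮b, j↮s₀}` of `M`
  set F1 : Set (BondConfig (Fin n)) := (openConn c b ∪ openConn d b) ∩ (openConn s₀ b)ᶜ ∩ (openConn s₀ c)ᶜ ∩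
      (openConn s₀ d)ᶜ ∩ (openConn s₀ j)ᶜ with hF1
  set G1 : Set (BondConfig (Fin n)) := openConn c b ∩ (openConn s₀ b)ᶜ ∩ (openConn j s₀)ᶜ with hG1
  have hincl1 : F1 ⊆ {ω : BondConfig (Fin n) | ((ω ∪ {s(c, d)} : Set (Sym2 (Fin n))) : BondConfig (Fin n)) ∈ G1} := by
    rintro ω ⟨⟨⟨⟨hX, hzb⟩, hzc⟩, hzd⟩, hzj⟩
    simp only [hG1, mem_setOf_eq, mem_inter_iff, mem_compl_iff]
    refine ⟨⟨?_, ?_⟩, ?_⟩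
    · show (openGraph _).Reachable c b
      rw [reachable_union_pair_iff]
      rcases hX with hc | hd
      · exact Or.inl hc
      · exact Or.inr (Or.inl ⟨SimpleGraph.Reachable.refl c, hd⟩)
    · intro h
      have h' : (openGraph _).Reachable s₀ b := h
      rw [reachable_union_pair_iff] at h'
      rcases h' with h1 | ⟨h1, -⟩ | ⟨h1, -⟩
      · exact hzb h1
      · exact hzc h1
      · exact hzd h1
    · intro h
      have h' : (openGraph _).Reachable j s₀ := h
      rw [reachable_union_pair_iff] at h'
      rcases h' with h1 | ⟨-, h1⟩ | ⟨-, h1⟩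
      · exact hzj h1.symm
      · exact hzd h1.symm
      · exact hzc h1.symm
  have hP1 : (prodBernoulli R).real F1 ≤ (prodBernoulli M).real G1 := by
    have a1 : (prodBernoulli L).real F1 ≤ (prodBernoulli M).real G1 := by
      rw [hpushL G1]; exact measureReal_mono hincl1 (measure_ne_top _ _)
    have a2 : (prodBernoulli M).real F1 ≤ (prodBernoulli M).real G1 := by
      rw [hpushM G1]; exact measureReal_mono hincl1 (measure_ne_top _ _)
    rw [hmixL F1]
    nlinarith [a1, a2, hu0, hu1]
  -- (P2) the second `R`-event contains the pull-back of `{s₀b, c↮b, j↔c}` of `M`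
  set F2 : Set (BondConfig (Fin n)) := openConn s₀ b ∩ (openConn c b)ᶜ ∩ (openConn d b)ᶜ ∩ (openConn j c ∪ openConn j d)
    with hF2
  set G2 : Set (BondConfig (Fin n)) := openConn s₀ b ∩ (openConn c b)ᶜ ∩ openConn j c with hG2
  have hincl2 : {ω : BondConfig (Fin n) | ((ω ∪ {s(c, d)} : Set (Sym2 (Fin n))) : BondConfig (Fin n)) ∈ G2} ⊆ F2 := by
    intro ω hω
    simp only [hG2, mem_setOf_eq, mem_inter_iff, mem_compl_iff] at hω
    obtain ⟨⟨hzb, hcb'⟩, hjc⟩ := hω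
    have hzb' : (openGraph _).Reachable s₀ b := hzb
    have hjc' : (openGraph _).Reachable j c := hjc
    rw [reachable_union_pair_iff] at hzb' hjc'
    have ncb : ¬ (openGraph ω).Reachable c b := fun h => hcb' (by
      show (openGraph _).Reachable c b
      rw [reachable_union_pair_iff]; exact Or.inl h)
    have ndb : ¬ (openGraph ω).Reachable d b := fun h => hcb' (by
      show (openGraph _).Reachable c b
      rw [reachable_union_pair_iff]; exact Or.inr (Or.inl ⟨SimpleGraph.Reachable.refl c, h⟩))
    refine ⟨⟨⟨?_, ncb⟩, ndb⟩, ?_⟩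
    · rcases hzb' with h1 | ⟨-, h1⟩ | ⟨-, h1⟩
      · exact h1
      · exact absurd h1 ndb
      · exact absurd h1 ncb
    · rcases hjc' with h1 | ⟨h1, -⟩ | ⟨h1, -⟩
      · exact Or.inl h1
      · exact Or.inl h1
      · exact Or.inr h1
  have hP2 : (prodBernoulli M).real G2 ≤ (prodBernoulli R).real F2 := by
    have a1 : (prodBernoulli M).real G2 ≤ (prodBernoulli L).real F2 := by
      rw [hpushL G2]; exact measureReal_mono hincl2 (measure_ne_top _ _)
    have a2 : (prodBernoulli M).real G2 ≤ (prodBernoulli M).real F2 := by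
      rw [hpushM G2]; exact measureReal_mono hincl2 (measure_ne_top _ _)
    rw [hmixL F2]
    nlinarith [a1, a2, hu0, hu1]
  -- (L5) `q ≤ s₀` in the mixture `R` (verbatim from `faceB_atom`)
  set R₀ : Sym2 (Fin n) → unitInterval := fun f => if f = s(c, d) then Set.Icc.convexComb (w s(c, d)) 1 u else w f with hR₀
  have hswapR : (fun e : Sym2 (Fin n) => if (∀ x ∈ e, x ∈ Y) ∧ ¬ e.IsDiag then 1 else R₀ e) = R := by
    have h := glue_modifyPair_comm w Y (c := c) (d := d) hcY (fun t => Set.Icc.convexComb t 1 u)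
    simpa only [hR₀, hR, hL] using h
  have hmixw : ∀ X : Set (BondConfig (Fin n)), (prodBernoulli R₀).real X =
      (1 - (u : ℝ)) * (prodBernoulli w).real X + (u : ℝ) * (prodBernoulli wP).real X :=
    fun X => real_raisePair_eq_mix w s(c, d) u X
  have hqyR : (prodBernoulli R₀).real (openConn q b) ≤ (prodBernoulli R₀).real (openConn y b) := by
    rw [hmixw, hmixw]; exact hqy
  have hL5 := stub_gluingLemma5 n R₀ Y q y b hy hbY hqyR
  rw [hswapR] at hL5
  have hUle : (prodBernoulli R).real (⋃ s ∈ Y, openConn s b) ≤ (prodBernoulli R).real (openConn s₀ b) := by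
    have hsub : (⋃ s ∈ Y, openConn s b : Set (BondConfig (Fin n))) ⊆
        openConn s₀ b ∪ ⋃ s ∈ Y, (openConn s₀ s)ᶜ := by
      intro ω hω
      rcases mem_iUnion₂.1 hω with ⟨s, hs, hsb⟩
      by_cases h0 : ω ∈ openConn s₀ s
      · exact Or.inl ((h0 : (openGraph ω).Reachable s₀ s).trans (hsb : (openGraph ω).Reachable s b))
      · exact Or.inr (mem_iUnion₂.2 ⟨s, hs, h0⟩)
    have hnull : ∀ s ∈ Y, (prodBernoulli R).real (openConn s₀ s)ᶜ = 0 := by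
      intro s hs
      by_cases hss : s₀ = s
      · subst hss
        have : ((openConn s₀ s₀)ᶜ : Set (BondConfig (Fin n))) = ∅ := by
          ext ω; simp only [mem_compl_iff, mem_empty_iff_false, iff_false, not_not]
          exact (SimpleGraph.Reachable.refl s₀ : (openGraph ω).Reachable s₀ s₀)
        rw [this, measureReal_empty]
      · apply real_not_openConn_eq_zero_of_surePair R s₀ s hss
        have hne : s(s₀, s) ≠ s(c, d) := by
          intro h
          have : s₀ ∈ s(c, d) := h ▸ Sym2.mem_mk_left s₀ s
          rcases Sym2.mem_iff.1 this with h1 | h1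
          · exact hcY (h1 ▸ hs₀)
          · exact hdY (h1 ▸ hs₀)
        have hin : (∀ x ∈ s(s₀, s), x ∈ Y) ∧ ¬ (s(s₀, s)).IsDiag :=
          ⟨fun x hx => by rcases Sym2.mem_iff.1 hx with rfl | rfl <;> assumption, by rw [Sym2.mk_isDiag_iff]; exact hss⟩
        simp only [hR, hL, if_neg hne, if_pos hin]
    calc (prodBernoulli R).real (⋃ s ∈ Y, openConn s b)
        ≤ (prodBernoulli R).real (openConn s₀ b ∪ ⋃ s ∈ Y, (openConn s₀ s)ᶜ) := measureReal_mono hsub (measure_ne_top _ _)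
      _ ≤ (prodBernoulli R).real (openConn s₀ b) + (prodBernoulli R).real (⋃ s ∈ Y, (openConn s₀ s)ᶜ) :=
          measureReal_union_le _ _
      _ ≤ (prodBernoulli R).real (openConn s₀ b) + ∑ s ∈ Y, (prodBernoulli R).real (openConn s₀ s)ᶜ := by
          gcongr; exact measureReal_biUnion_finset_le Y _
      _ = (prodBernoulli R).real (openConn s₀ b) := by rw [Finset.sum_eq_zero hnull, add_zero]
  have hT1 : (1 - (u : ℝ)) * (prodBernoulli L).real (openConn q b) + (u : ℝ) * (prodBernoulli M).real (openConn q b) ≤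
      (1 - (u : ℝ)) * (prodBernoulli L).real (openConn s₀ b) + (u : ℝ) * (prodBernoulli M).real (openConn s₀ b) := by
    rw [← hmixL, ← hmixL]; exact hL5.trans hUle
  -- inclusion–exclusion: `N` from `M` (verbatim from `faceB_atom`)
  have hI1 : (prodBernoulli N).real (openConn c b) =
      (prodBernoulli M).real (openConn c b) + (prodBernoulli M).real (openConn s₀ b ∩ (openConn c b)ᶜ) := by
    rw [(real_openConn_pair_eq M hcs₀ b).1]
    have hset : openConn c b ∪ openConn s₀ b = openConn c b ∪ (openConn s₀ b ∩ (openConn c b)ᶜ : Set (BondConfig (Fin n))) := by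
      ext ω; simp only [mem_union, mem_inter_iff, mem_compl_iff]; tauto
    rw [hset, measureReal_union _ ((hmeas _).inter (hmeas _))]
    exact Set.disjoint_left.2 fun ω h1 h2 => h2.2 h1
  have hI2 : (prodBernoulli N).real (openConn j b) ≤ (prodBernoulli M).real (openConn j b) +
      (prodBernoulli M).real (openConn s₀ b ∩ (openConn c b)ᶜ ∩ openConn j c) +
      (prodBernoulli M).real (openConn c b ∩ (openConn s₀ b)ᶜ ∩ openConn j s₀) := by
    rw [real_openConn_pair_third M hcs₀ j b]
    have hsub : (openConn j b ∪ openConn j c ∩ openConn s₀ b ∪ openConn j s₀ ∩ openConn c b : Set (BondConfig (Fin n))) ⊆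
        openConn j b ∪ (openConn s₀ b ∩ (openConn c b)ᶜ ∩ openConn j c) ∪ (openConn c b ∩ (openConn s₀ b)ᶜ ∩ openConn j s₀) := by
      rintro ω ((hjb | ⟨hjc, hsb⟩) | ⟨hjs, hcb⟩)
      · exact Or.inl (Or.inl hjb)
      · by_cases hcb : ω ∈ openConn c b
        · exact Or.inl (Or.inl ((hjc : (openGraph ω).Reachable j c).trans (hcb : (openGraph ω).Reachable c b)))
        · exact Or.inl (Or.inr ⟨⟨hsb, hcb⟩, hjc⟩)
      · by_cases hsb : ω ∈ openConn s₀ b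
        · exact Or.inl (Or.inl ((hjs : (openGraph ω).Reachable j s₀).trans (hsb : (openGraph ω).Reachable s₀ b)))
        · exact Or.inr ⟨⟨hcb, hsb⟩, hjs⟩
    calc (prodBernoulli M).real (openConn j b ∪ openConn j c ∩ openConn s₀ b ∪ openConn j s₀ ∩ openConn c b)
        ≤ (prodBernoulli M).real (openConn j b ∪ (openConn s₀ b ∩ (openConn c b)ᶜ ∩ openConn j c) ∪
            (openConn c b ∩ (openConn s₀ b)ᶜ ∩ openConn j s₀)) := measureReal_mono hsub (measure_ne_top _ _)
      _ ≤ (prodBernoulli M).real (openConn j b ∪ (openConn s₀ b ∩ (openConn c b)ᶜ ∩ openConn j c)) +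
            (prodBernoulli M).real (openConn c b ∩ (openConn s₀ b)ᶜ ∩ openConn j s₀) := measureReal_union_le _ _
      _ ≤ _ := by gcongr; exact measureReal_union_le _ _
  -- splits in `M`: `μ(cb) = μ(cb ∩ s₀b) + μ(cb \ s₀b)`, `μ(s₀b) = μ(s₀b ∩ cb) + μ(s₀b \ cb)`, `μ(cb \ s₀b) = μ(… ∩ js₀) + μ(… \ js₀)`
  have hS1 := measureReal_inter_add_sdiff (μ := prodBernoulli M) (s := openConn c b) (hmeas (openConn s₀ b)) (measure_ne_top _ _)
  have hS2 := measureReal_inter_add_sdiff (μ := prodBernoulli M) (s := openConn s₀ b) (hmeas (openConn c b)) (measure_ne_top _ _)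
  have hS3 := measureReal_inter_add_sdiff (μ := prodBernoulli M) (s := openConn c b \ openConn s₀ b) (hmeas (openConn j s₀))
    (measure_ne_top _ _)
  have e12 : (openConn c b ∩ openConn s₀ b : Set (BondConfig (Fin n))) = openConn s₀ b ∩ openConn c b := Set.inter_comm _ _
  have e2 : (openConn s₀ b \ openConn c b : Set (BondConfig (Fin n))) = openConn s₀ b ∩ (openConn c b)ᶜ := rfl
  have e3a : ((openConn c b \ openConn s₀ b) ∩ openConn j s₀ : Set (BondConfig (Fin n))) =
      openConn c b ∩ (openConn s₀ b)ᶜ ∩ openConn j s₀ := rfl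
  have e3b : ((openConn c b \ openConn s₀ b) \ openConn j s₀ : Set (BondConfig (Fin n))) = G1 := rfl
  rw [e12] at hS1
  rw [e3a, e3b] at hS3
  -- `G2` is the `M`-event subtracted in `hI2`
  have eG2 : (openConn s₀ b ∩ (openConn c b)ᶜ ∩ openConn j c : Set (BondConfig (Fin n))) = G2 := rfl
  rw [eG2] at hI2
  rw [e2] at hS2
  -- the `R`-reliabilities in `hSE` through the mixture
  have hRjm := hmixL (openConn j b)
  have hRs := hmixL (openConn s₀ b)
  -- (D) the merge-gain difference dominates `μ_R(jb) − μ_R(s₀b)` (all in the `M`/`N`/`R` worlds, no `u`)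
  have hD : (prodBernoulli R).real (openConn j b) - (prodBernoulli R).real (openConn s₀ b) ≤
      ((prodBernoulli N).real (openConn c b) - (prodBernoulli N).real (openConn j b)) -
        ((prodBernoulli M).real (openConn s₀ b) - (prodBernoulli M).real (openConn j b)) := by
    linarith [hSE, hP1, hP2, hI1, hI2, hS1, hS2, hS3]
  -- final combination (scaled by `u`, `1 - u`)
  have sD := mul_le_mul_of_nonneg_left hD hu0
  have sT1 := mul_le_mul_of_nonneg_left hT1 hu1
  have sRj := congrArg (fun t => (u : ℝ) * t) hRjm
  have sRj' := congrArg (fun t => (1 - (u : ℝ)) * t) hRjm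
  have sRs := congrArg (fun t => (u : ℝ) * t) hRs
  have sRs' := congrArg (fun t => (1 - (u : ℝ)) * t) hRs
  linarith [sD, sT1, sRj, sRj', sRs, sRs', hRs, hRjm]

end UpsetExchange

end

end Summit.CriticalPhenomena.PercolationContinuityZ3.Theorems
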